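import Mathlib
import Summits.Ventures.PercRepro2.HCov
import Summits.Ventures.PercRepro2.A3Fibre
import Summits.Ventures.PercRepro2.A3FibreLeft

/-!
# The two increasing cluster functions of the root-edge closure of (MEANS-a₃)
(blind cell PercRepro2, p5 g13; `proofs/P5-ROOTEDGE.md` §6, third block, part a)

`cbF W = 1_{b ∈ W} − (1 − 1_{b ∈ W})·P(Rv b W)` (the `e`-free `b`-mean of a T′-fibre, A3RootEdgeFibre)
and `cFF γ W = γ − 2(1 − 1_{o ∈ W})·P(Rv o W)` (the `e`-free `F`-mean at the constant `γ`), extended to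
sets through `Set.toFinset` (`cbS`, `cFS`; `cbS_coe`, `cFS_coe`).  Both are MONOTONE (`cbF_mono`,
`cFF_mono`, `cbS_mono`, `cFS_mono`: the deleted-graph event `Rv` is antitone in `W`, `prob_Rv_anti`)
and bounded below (`cbS_add_one_nonneg`, `cFS_add_two_nonneg` for `γ ≥ 0`) — the shape BHK 1.3 for
monotone functions (`bhk_same_cluster`) needs.
-/

namespace Summit.Ventures.PercRepro2

open UnionCluster

namespace CovForm

namespace RootEdge

open A3Fibre

section ClusterFns

open Classical

variable {V : Type*} {E : Type*} [Fintype V] [DecidableEq V] [Fintype E] [DecidableEq E]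
  {R : Type*} [Field R] [LinearOrder R] [IsStrictOrderedRing R]

/-! ### The two increasing cluster functions -/

omit [LinearOrder R] [IsStrictOrderedRing R] in
/-- The `e`-free `b`-mean on a finset: `1_{b ∈ W} − (1 − 1_{b ∈ W})·P(a₂ ↔ b in G − W)`. -/
noncomputable def cbF (p : E → R) (ends : E → Sym2 V) (a₂ b : V) (W : Finset V) : R :=
  if b ∈ W then 1 else -prob p (Rv ends a₂ b W)

omit [LinearOrder R] [IsStrictOrderedRing R] in
/-- The `e`-free `F`-mean at the constant `γ` on a finset: `γ − 2(1 − 1_{o ∈ W})·P(a₂ ↔ o in G − W)`. -/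
noncomputable def cFF (p : E → R) (ends : E → Sym2 V) (a₂ o : V) (γ : R) (W : Finset V) : R :=
  γ + (if o ∈ W then 0 else -2 * prob p (Rv ends a₂ o W))

omit [LinearOrder R] [IsStrictOrderedRing R] in
/-- `cbF` as a function of a set (through `Set.toFinset`). -/
noncomputable def cbS (p : E → R) (ends : E → Sym2 V) (a₂ b : V) (S : Set V) : R :=
  cbF p ends a₂ b S.toFinset

omit [LinearOrder R] [IsStrictOrderedRing R] in
/-- `cFF` as a function of a set (through `Set.toFinset`). -/
noncomputable def cFS (p : E → R) (ends : E → Sym2 V) (a₂ o : V) (γ : R) (S : Set V) : R :=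
  cFF p ends a₂ o γ S.toFinset

omit [LinearOrder R] [IsStrictOrderedRing R] in
/-- On a finset, `cbS` is the constant of `Ssig_update_eq_mul`. -/
lemma cbS_coe (p : E → R) (ends : E → Sym2 V) (a₂ b : V) (W : Finset V) :
    cbS p ends a₂ b (↑W : Set V) = (if b ∈ W then (1 : R) else -prob p (Rv ends a₂ b W)) := by
  rw [cbS, Finset.toFinset_coe, cbF]

omit [LinearOrder R] [IsStrictOrderedRing R] in
/-- On a finset, `cFS` is the constant of `term_update_of_mem`. -/
lemma cFS_coe (p : E → R) (ends : E → Sym2 V) (a₂ o : V) (γ : R) (W : Finset V) :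
    cFS p ends a₂ o γ (↑W : Set V) =
      γ + (if o ∈ W then (0 : R) else -2 * prob p (Rv ends a₂ o W)) := by
  rw [cFS, Finset.toFinset_coe, cFF]

omit [Fintype V] [DecidableEq V] [Fintype E] [DecidableEq E] [LinearOrder R] [IsStrictOrderedRing R] in
/-- `restrict` is monotone in the kept set. -/
lemma restrict_mono_set {F F' : Set E} [DecidablePred (· ∈ F)] [DecidablePred (· ∈ F')]
    (h : F ⊆ F') (ω : Config E) : restrict F ω ≤ restrict F' ω := by
  intro e
  simp only [restrict]
  by_cases he : e ∈ F
  · simp [he, h he]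
  · simp [he]

omit [Fintype V] [DecidableEq V] [Fintype E] [DecidableEq E] [LinearOrder R] [IsStrictOrderedRing R] in
/-- `touches` is monotone. -/
lemma touches_mono {ends : E → Sym2 V} {S S' : Set V} (h : S ⊆ S') :
    touches ends S ⊆ touches ends S' := by
  rintro e ⟨x, hx, y, hxy⟩
  exact ⟨x, h hx, y, hxy⟩

/-- Deleting more vertices makes the deleted-graph connection rarer: `Rv` is antitone. -/
lemma prob_Rv_anti (p : E → R) (hp : IsProbVec p) (ends : E → Sym2 V) (a₂ v : V)
    {W W' : Finset V} (h : W ⊆ W') :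
    prob p (Rv ends a₂ v W') ≤ prob p (Rv ends a₂ v W) := by
  unfold Rv
  refine prob_mono hp fun ω hω => ?_
  exact conn_mono (restrict_mono_set (Set.compl_subset_compl.2
    (touches_mono (Finset.coe_subset.2 h))) ω) hω

/-- `cbF` is monotone. -/
lemma cbF_mono (p : E → R) (hp : IsProbVec p) (ends : E → Sym2 V) (a₂ b : V) :
    Monotone (cbF p ends a₂ b) := by
  intro W W' h
  by_cases hb : b ∈ W
  · rw [cbF, cbF, if_pos hb, if_pos (h hb)]
  · by_cases hb' : b ∈ W'
    · rw [cbF, cbF, if_neg hb, if_pos hb']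
      have := prob_nonneg hp (Rv ends a₂ b W)
      linarith
    · rw [cbF, cbF, if_neg hb, if_neg hb']
      exact neg_le_neg (prob_Rv_anti p hp ends a₂ b h)

/-- `cFF` is monotone. -/
lemma cFF_mono (p : E → R) (hp : IsProbVec p) (ends : E → Sym2 V) (a₂ o : V) (γ : R) :
    Monotone (cFF p ends a₂ o γ) := by
  intro W W' h
  by_cases ho : o ∈ W
  · rw [cFF, cFF, if_pos ho, if_pos (h ho)]
  · by_cases ho' : o ∈ W'
    · rw [cFF, cFF, if_neg ho, if_pos ho']
      have := prob_nonneg hp (Rv ends a₂ o W)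
      linarith
    · rw [cFF, cFF, if_neg ho, if_neg ho']
      have := prob_Rv_anti p hp ends a₂ o h
      linarith

/-- `cbS` is monotone. -/
lemma cbS_mono (p : E → R) (hp : IsProbVec p) (ends : E → Sym2 V) (a₂ b : V) :
    Monotone (cbS p ends a₂ b) := fun _ _ h =>
  cbF_mono p hp ends a₂ b (Set.toFinset_subset_toFinset.2 h)

/-- `cFS` is monotone. -/
lemma cFS_mono (p : E → R) (hp : IsProbVec p) (ends : E → Sym2 V) (a₂ o : V) (γ : R) :
    Monotone (cFS p ends a₂ o γ) := fun _ _ h =>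
  cFF_mono p hp ends a₂ o γ (Set.toFinset_subset_toFinset.2 h)

/-- `cbF + 1 ≥ 0`. -/
lemma cbF_add_one_nonneg (p : E → R) (hp : IsProbVec p) (ends : E → Sym2 V) (a₂ b : V)
    (W : Finset V) : 0 ≤ cbF p ends a₂ b W + 1 := by
  by_cases hb : b ∈ W
  · rw [cbF, if_pos hb]; norm_num
  · rw [cbF, if_neg hb]
    have h1 := prob_mono hp (Set.subset_univ (Rv ends a₂ b W))
    rw [prob_univ] at h1
    linarith

/-- `cFF + 2 ≥ 0` when `γ ≥ 0`. -/
lemma cFF_add_two_nonneg (p : E → R) (hp : IsProbVec p) (ends : E → Sym2 V) (a₂ o : V) {γ : R}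
    (hγ : 0 ≤ γ) (W : Finset V) : 0 ≤ cFF p ends a₂ o γ W + 2 := by
  by_cases ho : o ∈ W
  · rw [cFF, if_pos ho]; linarith
  · rw [cFF, if_neg ho]
    have h1 := prob_mono hp (Set.subset_univ (Rv ends a₂ o W))
    rw [prob_univ] at h1
    linarith

/-- `cbS + 1 ≥ 0`. -/
lemma cbS_add_one_nonneg (p : E → R) (hp : IsProbVec p) (ends : E → Sym2 V) (a₂ b : V)
    (S : Set V) : 0 ≤ cbS p ends a₂ b S + 1 :=
  cbF_add_one_nonneg p hp ends a₂ b _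

/-- `cFS + 2 ≥ 0` when `γ ≥ 0`. -/
lemma cFS_add_two_nonneg (p : E → R) (hp : IsProbVec p) (ends : E → Sym2 V) (a₂ o : V) {γ : R}
    (hγ : 0 ≤ γ) (S : Set V) : 0 ≤ cFS p ends a₂ o γ S + 2 :=
  cFF_add_two_nonneg p hp ends a₂ o hγ _

end ClusterFns

end RootEdge

end CovForm

end Summit.Ventures.PercRepro2
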